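import Summits.CriticalPhenomena.PercolationContinuityZ3.Theorems.PercNearOneGluingNoHeavyLowerTailIncStarCycle
import Literature.Probability.Percolation.UniquenessInfiniteCluster
import Literature.Combinatorics.Sahi2008.PushForward
import HarnessLib

/-!
# The increasing star on a weighted cycle with an ARBITRARY root (relabelling)

Support file for the Sahi programme (`--supports stmt-CriticalPhenomena-4575`, prover prim-sahi-p2 gen 8).
No definitions, no named facts, no sorries; standard axioms.  Memo `…/prim-sahi-p2/PROOF-E3.md` §19.

`…IncStarCycle.lean` proves Sahi positivity of every order for the root-cluster events of a weighted cycle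
with the root at the vertex `0`.  Here the root is arbitrary: a relabelling of the vertices along a bijection
`φ` carries the product weight `w` to `w ∘ Sym2.map φ` and the connection events to connection events
(`sahiE_ind_openConn_relabel`, a general symmetry of `E_n` of connection indicators, any finite graph), and the
rotation `v ↦ v + s` of `Fin m` preserves the set of cycle edges `s(j, j+1)`.

* `sahiE_rootCluster_cycle_nonneg_rooted` — `0 ≤ E_n(1_{s↔t₀}, …, 1_{s↔t_{n−1}})` for every root `s`;
* `incStar_cycle_nonneg_rooted` — `0 ≤ sahiE3 (prodBernoulli w) (openConn s b) (openConn s c) (openConn s y)`.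
-/

noncomputable section

namespace Summit.CriticalPhenomena.PercolationContinuityZ3.Theorems

namespace IncStarCycle

open Finset MeasureTheory Literature.Combinatorics.Sahi2008 Literature.Probability.Percolation
  Literature.Probability.LatticeModels
open Literature.Probability.Percolation.DecisionTree (ind ind_of_mem ind_of_not_mem ind_nonneg)
open Literature.Probability.Percolation.BHK2006 (weight)
open scoped Classical

/-! ### Relabelling symmetry of `E_n` of connection indicators (any finite graph) -/

section Relabel

variable {V W : Type*} [Fintype V] [Fintype W]

/-- The product weight of a relabelled configuration is the product weight, with relabelled parameters, of the
configuration: `weight_w(φ·ω) = weight_{w ∘ φ}(ω)`. [folklore] -/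
theorem bernoulliWeight_relabel (φ : V ≃ W) (w : Sym2 W → unitInterval) (ω : BondConfig V) :
    bernoulliWeight w (BondConfig.relabel (sym2Equiv φ) ω) = bernoulliWeight (w ∘ sym2Equiv φ) ω := by
  unfold bernoulliWeight weight
  rw [← (sym2Equiv φ).prod_comp]
  refine Finset.prod_congr rfl fun e _ => ?_
  have hmem : sym2Equiv φ e ∈ BondConfig.relabel (sym2Equiv φ) ω ↔ e ∈ ω := by
    rw [BondConfig.mem_relabel_iff, Equiv.symm_apply_apply]
  simp only [Function.comp_apply, hmem]

/-- **Relabelling symmetry.**  For a bijection `φ : V ≃ W` of the vertices, `E_n` of the connection indicators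
`1_{φ s ↔ φ tᵢ}` under the product weight `w` equals `E_n` of `1_{s ↔ tᵢ}` under the relabelled weight
`w ∘ Sym2.map φ`. [folklore] -/
theorem sahiE_ind_openConn_relabel (φ : V ≃ W) (w : Sym2 W → unitInterval) (n : ℕ) (s : V) (t : Fin n → V) :
    sahiE (bernoulliWeight w) n (fun i => ind (openConn (φ s) (φ (t i)))) =
      sahiE (bernoulliWeight (w ∘ sym2Equiv φ)) n (fun i => ind (openConn s (t i))) := by
  set Φ : BondConfig V ≃ BondConfig W := (BondConfig.relabel (sym2Equiv φ)).toEquiv with hΦ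
  have hpush : pushWeight (bernoulliWeight (w ∘ sym2Equiv φ)) Φ = bernoulliWeight w := by
    funext c
    rw [pushWeight_equiv, ← bernoulliWeight_relabel φ w (Φ.symm c)]
    exact congrArg _ (Φ.apply_symm_apply c)
  rw [← hpush, sahiE_pushWeight]
  congr 1
  funext i ω
  simp only [Function.comp_apply]
  have hiff : Φ ω ∈ openConn (φ s) (φ (t i)) ↔ ω ∈ openConn s (t i) := reachable_relabel_iff φ ω s (t i)
  by_cases h : ω ∈ openConn s (t i)
  · rw [ind_of_mem h, ind_of_mem (hiff.2 h)]
  · rw [ind_of_not_mem h, ind_of_not_mem (fun h' => h (hiff.1 h'))]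

end Relabel

/-! ### Cycles with an arbitrary root -/

variable {m : ℕ} [NeZero m]

/-- The rotation `v ↦ v + s` maps cycle edges to cycle edges: if `w` vanishes off the edges `s(j, j+1)` then so
does `w ∘ Sym2.map (· + s)`. [folklore] -/
theorem rotate_vanishes_off_cycle (w : Sym2 (Fin m) → unitInterval)
    (hw : ∀ e : Sym2 (Fin m), (∀ j : Fin m, e ≠ s(j, j + 1)) → w e = 0) (s : Fin m) :
    ∀ e : Sym2 (Fin m), (∀ j : Fin m, e ≠ s(j, j + 1)) → (w ∘ sym2Equiv (Equiv.addRight s)) e = 0 := by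
  intro e he
  simp only [Function.comp_apply]
  refine hw _ fun j hj => ?_
  -- `Sym2.map (· + s) e = s(j, j+1)` forces `e = s(j - s, (j - s) + 1)`
  have : e = s(j - s, j - s + 1) := by
    have h2 := congrArg (sym2Equiv (Equiv.addRight s)).symm hj
    rw [Equiv.symm_apply_apply, sym2Equiv_symm, sym2Equiv_mk] at h2
    rw [h2]
    refine congrArg₂ (fun a b => s(a, b)) ?_ ?_
    · simp [sub_eq_add_neg]
    · have h3 : ((Equiv.addRight s).symm (j + 1) : Fin m) = j + 1 + -s := by simp
      rw [h3]
      abel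
  exact he (j - s) this

/-- **Sahi positivity of every order for the root-cluster events of a weighted cycle, arbitrary root.**  Let
`m ≥ 3` and let `w` vanish off the cycle edges `s(j, j+1)`; then for every root `s`, every `n` and all targets
`t : Fin n → Fin m`, `0 ≤ E_n(1_{s↔t 0}, …, 1_{s↔t (n−1)})`. [this work] -/
theorem sahiE_rootCluster_cycle_nonneg_rooted (hm : 3 ≤ m) (w : Sym2 (Fin m) → unitInterval)
    (hw : ∀ e : Sym2 (Fin m), (∀ j : Fin m, e ≠ s(j, j + 1)) → w e = 0) (s : Fin m) (n : ℕ)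
    (t : Fin n → Fin m) :
    0 ≤ sahiE (bernoulliWeight w) n (fun i => ind (openConn s (t i))) := by
  set φ : Fin m ≃ Fin m := Equiv.addRight s with hφ
  have hs : φ 0 = s := by simp [hφ]
  have ht : ∀ i, φ (t i - s) = t i := by intro i; simp [hφ]
  have key := sahiE_ind_openConn_relabel φ w n 0 (fun i => t i - s)
  simp only [hs, ht] at key
  rw [key]
  exact sahiE_rootCluster_cycle_nonneg hm (w ∘ sym2Equiv φ) (rotate_vanishes_off_cycle w hw s) n _

/-- **The increasing star on every weighted cycle, arbitrary root**: `0 ≤ E₃({s↔b},{s↔c},{s↔y})` for bond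
percolation on `C_m` (`m ≥ 3`, edges `s(j, j+1)`) with arbitrary edge weights, root and targets. [this work] -/
theorem incStar_cycle_nonneg_rooted (hm : 3 ≤ m) (w : Sym2 (Fin m) → unitInterval)
    (hw : ∀ e : Sym2 (Fin m), (∀ j : Fin m, e ≠ s(j, j + 1)) → w e = 0) (s b c y : Fin m) :
    0 ≤ sahiE3 (prodBernoulli w) (openConn s b) (openConn s c) (openConn s y) := by
  rw [← sahiE_three_ind]
  have h := sahiE_rootCluster_cycle_nonneg_rooted hm w hw s 3 ![b, c, y]
  have hf : (fun i : Fin 3 => ind (openConn s ((![b, c, y] : Fin 3 → Fin m) i))) =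
      ![ind (openConn s b), ind (openConn s c), ind (openConn s y)] := by
    funext i; fin_cases i <;> rfl
  rw [hf] at h
  exact h

end IncStarCycle

end Summit.CriticalPhenomena.PercolationContinuityZ3.Theorems
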